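import Summits.HubbardSuperconductivity.HubbardSuperconductivity.Theses.ChiralWindow

/-!
# Route `ChiralWindow` — assembly item `Assembly` (stmt-HubbardSuperconductivity-1746)

`Assembly : CwThesis → HubbardSuperconductivity` is pure logic.  `CwThesis` delivers a coupling
ceiling `U₀ > 0` and, for EVERY `U ∈ (0, U₀)`, a doping `δ ∈ [3/10, 12/25]` at which the summit's
matrix holds word for word (every normalised even-torus `(N_L, S^z = 0)`-sector ground-state sequence
of `hubbardTorus 2 L 1 U`, `N_L = 2⌊(1-δ)L²/2⌋`, has `d_{x²-y²}` pair-field long-range order).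
Instantiate `U := U₀/2 ∈ (0, U₀)` and use `[3/10, 12/25] ⊂ (0, 1/2)`; the matrix is literally the
body of `Literature.Hubbard.DWaveSuperconductivityHubbard`, which `HubbardSuperconductivity` unfolds
to.  Nothing else is used.
-/

namespace Summit.HubbardSuperconductivity.HubbardSuperconductivity.Theorems

open Summit.HubbardSuperconductivity.HubbardSuperconductivity.Theses.ChiralWindow

/-- **Assembly of route `ChiralWindow`** (stmt-HubbardSuperconductivity-1746): the route thesis
`CwThesis` (for every weak repulsive `U < U₀` a doping `δ_U ∈ [3/10, 12/25]` at which every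
even-torus sector ground-state sequence of `hubbardTorus 2 L 1 U` has `d_{x²-y²}` pair-field LRO)
implies the summit statement `HubbardSuperconductivity`
(`= Literature.Hubbard.DWaveSuperconductivityHubbard`: `∃ U > 0, ∃ δ ∈ (0, 1/2), …` with the same
matrix).  Pure logic: `U := U₀/2`, and `[3/10, 12/25] ⊂ (0, 1/2)`. [folklore] -/
theorem cwAssembly_proof :
    Summit.HubbardSuperconductivity.HubbardSuperconductivity.Theses.ChiralWindow.Assembly := by
  unfold Summit.HubbardSuperconductivity.HubbardSuperconductivity.Theses.ChiralWindow.Assembly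
    Summit.HubbardSuperconductivity.HubbardSuperconductivity.Theses.ChiralWindow.CwThesis
    _root_.HubbardSuperconductivity Literature.Hubbard.DWaveSuperconductivityHubbard
  rintro ⟨U₀, hU₀, h⟩
  have hU : U₀ / 2 ∈ Set.Ioo (0 : ℝ) U₀ := ⟨by linarith, by linarith⟩
  obtain ⟨δ, hδ, hmat⟩ := h (U₀ / 2) hU
  have hδ' : δ ∈ Set.Ioo (0 : ℝ) (1 / 2) := ⟨by linarith [hδ.1], by linarith [hδ.2]⟩
  exact ⟨U₀ / 2, hU.1, δ, hδ', hmat⟩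

end Summit.HubbardSuperconductivity.HubbardSuperconductivity.Theorems
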